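import Summits.QuantumFields.YangMills.Theorems.BalabanUVNodesK0Stub1Letters10OnA1OfFlatSocket
import Summits.QuantumFields.YangMills.Theorems.BalabanUVNodesN07FlatCurrentA1LineRowsAtRecordLam
import HarnessLib

/-!
# N07 (d′)-Lam, (R1) W4: the (158) letters `Letters10On` of `A₁ = ⇑X − H_V(Q_V ⇑X)` from the ♭ socket, criticality in CELL FORM (S4-Lam, fourth wrapper)

WHY (n07-e memo `LOCATED-DPRIME-CALIBRATION` §4 (R1), `DPRIME-LAM-ROADMAP` §2).  S4 = k0-s1-w1's `exists_letters10On_A1_of_flatSocket_T4` is the supplier the N07 head token's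
displayed hypothesis (d′) `hA1` (MODULE 100 :110–176) is calibrated against; its in-edge `IsCritOnFibre F N K 𝔹 …` (determining set `𝔹` with `bondsOf 𝔹 ⊆ LamBonds`) is more than
print's criticality ([15] (156)–(157)) and is not available at a datum of the record, whereas the cell form is (n07-e MODULES 101–104).  This file is S4 over the cell-form chain
W1–W3b (n07-e MODULES 109–112); n07-w4's near-top door (W5-Lam) and the assembly of `hA1`-Lam continue from it.

WHAT IS PROVED (sorry-free; no definition; axioms standard): ★★★★ `exists_letters10On_A1_of_flatSocket_T4_lam` — k0-s1-w1's statement VERBATIM with the binders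
`(𝔹) (_ : bondsOf 𝔹 ⊆ LamBonds ≤ K − n) (U₁) (reading) (_ : IsCritOnFibre …)` replaced by `(U₁) (reading) (_ : cell-form criticality)`; proof VERBATIM over W3b-Lam.
HONEST FRAMING: a re-cut of one wrapper, no new analysis; NOTHING of [15]'s estimates asserted beyond the cited k0-s1 files; (d′) ∕ `HThm4RecDbar` ∕ budget row of MODULE 100
untouched — this is the SUPPLIER side only, the assembly of (d′)-Lam is separate; K0⁷ NOT closed; N07 NOT discharged; counts unmoved; one finite 𝕋⁴ programme at fixed ε — NOT
continuum ∕ ℝ⁴ ∕ OS ∕ mass gap ∕ Clay.  No `sorry`, no `def`, no `instance`, no `notation`.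

References: [15] = Balaban1985Variational (27) p.282, (44)–(50) p.285, (55) p.286, (127)–(128) p.297, (152)–(153) p.301, (156)–(159) pp.302–303; Balaban1985Averaging (92)
p.31, Prop. 4 (134)–(135) p.38; Balaban1984PropagatorsII (2.3) p.224, (2.35) p.228; Balaban1988Convergent (2.10)–(2.12) p.256.
-/

set_option autoImplicit false

noncomputable section

open scoped BigOperators Matrix Matrix.Norms.L2Operator InnerProductSpace RealInnerProductSpace ContDiff

namespace Summit.QuantumFields.YangMills.BalabanUVNodes.N07Letters10OnA1OfFlatSocketLam

open Literature.MathematicalPhysics.QuantumFieldTheory.Balaban1983to89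
open Literature.MathematicalPhysics.QuantumFieldTheory.Balaban1983to89.Node00
open T4Continuum (T4Family)
open T4AdjointCovarianceUnitary (lieSU mem_lieSU_iff)
open B9AdOrthogonal (herm0)
open B15DeterminingSets (bondsOf DetSet avgFamily)
open B6SectADomainsV1 (Domains)
open B6SectAOperatorsV1 (BondIdx QE QsE RE dsE)
open B6SectAVectorModelV1 (deltaAE GE EE)
open B6SectA (hOp)
open Summit.QuantumFields.YangMills.Theorems.FlatCubeOpsText (Adm22)
open Summit.QuantumFields.YangMills.Theorems.K0FlatCubeOpsTextP (IsLevWeight flatH levWeight_nonneg)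
open Summit.QuantumFields.YangMills.Theorems.Prop8Chart (expCfg)
open Summit.QuantumFields.YangMills.Theorems.Prop8ChartDoubleBar (chartLogFlat)
open Summit.QuantumFields.YangMills.BalabanUVNodes.N07HalvingStepTopOfLocalLetters (Letters10On)
open Summit.QuantumFields.YangMills.Theorems.K0Stub1Letters10OnA1 (exists_letters10On_A1_closed_of_adm22_T4)
open Summit.QuantumFields.YangMills.Theorems.K0Stub1H128OfFlatSocket (h128_of_socket127_flat re_trace_pairing_rescaled_current_traceless inv_I_eta_smul_mem_herm0)
open Summit.QuantumFields.YangMills.Theorems.K0Stub1FlatCurrentA1LineRows (norm_inv_I_eta_smul)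
open Summit.QuantumFields.YangMills.BalabanUVNodes.N07FlatCurrentA1LineRowsAtRecordLam (exists_sectF_W_flatScaled_atRecord_socket_A1rows_lam)
open Summit.QuantumFields.YangMills.Theorems.K0Stub1Letters10OnA1OfFlatSocket (hermLetter_rows_lt)

variable {N : ℕ} [NeZero N]


/-- ★★★★ **THE (158) LETTERS `Letters10On` OF `A₁ = ⇑X − H_V(Q_V ⇑X)` FROM THE ♭ SOCKET — CELL-FORM (Lam) EDITION** of k0-s1-w1
`K0Stub1Letters10OnA1OfFlatSocket.exists_letters10On_A1_of_flatSocket_T4`: the SAME thresholds, family letters, operator letters, chart parameter `X` with its two size rows and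
the slice row, `U₁` reading the charted point, window `Y ⊆ Ω_{K−n}` and threshold, EXCEPT that the criticality of `U₁` is asked in the CORE's cell form (stationarity of `𝔄` along
differentiable `SU(N)` curves through `U₁` keeping the averages on the (2.3) CELLS `D.LamBond j c`, `j ≤ K − n`) instead of `IsCritOnFibre F N K 𝔹 …` for a determining set.
Proof = k0-s1-w1's VERBATIM (`exists_letters10On_A1_closed_of_adm22_T4`, `h128_of_socket127_flat`, `hermLetter_rows_lt`, … cited by name) over n07-e W3b-Lam
`exists_sectF_W_flatScaled_atRecord_socket_A1rows_lam`.
[cite: Balaban1985Variational, (27) p.282, (44)-(50) p.285, (55) p.286, (127)-(128) p.297, (152)-(153) p.301, (156)-(159) pp.302-303; Balaban1985Averaging, (92) p.31, Prop. 4 (134)-(135) p.38; Balaban1984PropagatorsII, (2.3) p.224, (2.35) p.228; Balaban1988Convergent, (2.10)-(2.12) p.256] -/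
theorem exists_letters10On_A1_of_flatSocket_T4_lam (F : T4Family) :
    ∃ (Mh₀ R₀ : ℕ) (B₀ δ₀ B₃ CG ε C₄ : ℝ), 0 < δ₀ ∧ 0 < B₃ ∧ 0 ≤ CG ∧ 0 < ε ∧ 0 ≤ C₄ ∧
    ∀ (n K : ℕ) (_ : 1 ≤ K - n) (_ : K - n + 1 ≤ F.m + K) {Mh R a' : ℕ} (_ : Mh = F.L ^ a') (_ : Mh₀ ≤ Mh) (_ : R₀ ≤ R)
      (_ : a' + 3 ≤ F.m + n) (D : Domains (F.P K)) (_ : D.k = K - n) (_ : Adm22 D R (F.L * Mh))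
      (w : ℕ → PBond (F.P K) 0 → ℝ) (_ : IsLevWeight (F.P K) (K - n) D w),
    -- Sect. F's ♭ chart at this family, RE-EXPORTED with its defining rows
    ∃ (H : (BondIdx D → Matrix (Fin N) (Fin N) ℂ) →ₗ[ℂ] (PBond (F.P K) 0 → Matrix (Fin N) (Fin N) ℂ))
      (Dsel : (PBond (F.P K) 0 → Matrix (Fin N) (Fin N) ℂ) → (BondIdx D → Matrix (Fin N) (Fin N) ℂ)),
      (∀ (X : BondIdx D → Matrix (Fin N) (Fin N) ℂ) (b : PBond (F.P K) 0), H X b =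
        ∑ t, (((((F.P K).L : ℝ) ^ (t.1.1 : ℕ) * ((((F.P K).L : ℝ))⁻¹) ^ (K - n))⁻¹ * flatH (F.P K) (K - n) D (Pi.single t 1) b : ℝ) : ℂ) • X t) ∧
      (∀ A' : PBond (F.P K) 0 → Matrix (Fin N) (Fin N) ℂ, (∀ b, w 1 b * ‖A' b‖ < ε) →
        ∀ ρ' : ℝ, 0 ≤ ρ' → (∀ b, w 1 b * ‖A' b‖ ≤ ρ') → ∀ i : BondIdx D, ‖Dsel A' i‖ ≤ C₄ * ρ' ^ 2) ∧
      ContDiffOn ℂ ω Dsel {Y : PBond (F.P K) 0 → Matrix (Fin N) (Fin N) ℂ | ∀ b, w 1 b * ‖Y b‖ < ε} ∧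
      (∀ A' : PBond (F.P K) 0 → Matrix (Fin N) (Fin N) ℂ, (∀ b, w 1 b * ‖A' b‖ < ε) →
        chartLogFlat (((((F.P K).L : ℝ))⁻¹) ^ (K - n)) D (A' - H (Dsel A')) - (fderiv ℂ (chartLogFlat (((((F.P K).L : ℝ))⁻¹) ^ (K - n)) D :
        (PBond (F.P K) 0 → Matrix (Fin N) (Fin N) ℂ) → BondIdx D → Matrix (Fin N) (Fin N) ℂ) 0) (A' - H (Dsel A')) = Dsel A' ∧
        chartLogFlat (((((F.P K).L : ℝ))⁻¹) ^ (K - n)) D (A' - H (Dsel A')) = (fderiv ℂ (chartLogFlat (((((F.P K).L : ℝ))⁻¹) ^ (K - n)) D :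
        (PBond (F.P K) 0 → Matrix (Fin N) (Fin N) ℂ) → BondIdx D → Matrix (Fin N) (Fin N) ℂ) 0) A') ∧
      (∀ A' : PBond (F.P K) 0 → Matrix (Fin N) (Fin N) ℂ, (∀ b, w 1 b * ‖A' b‖ < ε) → (∀ b, A' b ∈ herm0 (Fin N)) →
        (∀ i, Dsel A' i ∈ herm0 (Fin N)) ∧ ∀ b, (A' - H (Dsel A')) b ∈ herm0 (Fin N)) ∧
      -- THE A₁ LINE: p595460's kernel-formula letters; then every small 𝔰𝔲(N)-valued `X` on the slice whose charted point is critical on the record's fibre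
      ∀ {instDE : DecidableEq (PBond (F.P K) 0)} {instDB : DecidableEq (BondIdx D)}
    {DV GV MV : (PBond (F.P K) 0 → Matrix (Fin N) (Fin N) ℂ) →ₗ[ℂ] (PBond (F.P K) 0 → Matrix (Fin N) (Fin N) ℂ)}
    {QV : (PBond (F.P K) 0 → Matrix (Fin N) (Fin N) ℂ) →ₗ[ℂ] (BondIdx D → Matrix (Fin N) (Fin N) ℂ)}
    {HV : (BondIdx D → Matrix (Fin N) (Fin N) ℂ) →ₗ[ℂ] (PBond (F.P K) 0 → Matrix (Fin N) (Fin N) ℂ)}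
    (_ : ∀ (A : PBond (F.P K) 0 → Matrix (Fin N) (Fin N) ℂ) (b : PBond (F.P K) 0),
      DV A b = ∑ j, ((WithLp.ofLp (deltaAE D ((F.P K).L ^ (K - n) : ℝ) (fun _ => (1 : ℝ)) (WithLp.toLp 2 (Pi.single j 1))) b : ℝ) : ℂ) • A j)
    (_ : ∀ (A : PBond (F.P K) 0 → Matrix (Fin N) (Fin N) ℂ) (b : PBond (F.P K) 0),
      GV A b = ∑ j, ((WithLp.ofLp ((GE D (c := ((F.P K).L : ℝ) ^ (K - n)) (pow_ne_zero _ (Nat.cast_ne_zero.2 (F.P K).L_pos.ne')) (w := fun _ => (1 : ℝ)) (fun _ => one_pos)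
        - hOp (GE D (c := ((F.P K).L : ℝ) ^ (K - n)) (pow_ne_zero _ (Nat.cast_ne_zero.2 (F.P K).L_pos.ne')) (w := fun _ => (1 : ℝ)) (fun _ => one_pos)) (QsE D)
            (EE D (c := ((F.P K).L : ℝ) ^ (K - n)) (pow_ne_zero _ (Nat.cast_ne_zero.2 (F.P K).L_pos.ne')) (w := fun _ => (1 : ℝ)) (fun _ => one_pos))
          ∘ₗ QE D ∘ₗ GE D (c := ((F.P K).L : ℝ) ^ (K - n)) (pow_ne_zero _ (Nat.cast_ne_zero.2 (F.P K).L_pos.ne')) (w := fun _ => (1 : ℝ)) (fun _ => one_pos))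
        (WithLp.toLp 2 (Pi.single j 1))) b : ℝ) : ℂ) • A j)
    (_ : ∀ (A : PBond (F.P K) 0 → Matrix (Fin N) (Fin N) ℂ) (t : BondIdx D),
      QV A t = ∑ j, ((WithLp.ofLp (QE D (WithLp.toLp 2 (Pi.single j 1))) t : ℝ) : ℂ) • A j)
    (_ : ∀ (B : BondIdx D → Matrix (Fin N) (Fin N) ℂ) (b : PBond (F.P K) 0),
      HV B b = ∑ t, ((WithLp.ofLp (hOp (GE D (c := ((F.P K).L : ℝ) ^ (K - n)) (pow_ne_zero _ (Nat.cast_ne_zero.2 (F.P K).L_pos.ne')) (w := fun _ => (1 : ℝ)) (fun _ => one_pos))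
        (QsE D) (EE D (c := ((F.P K).L : ℝ) ^ (K - n)) (pow_ne_zero _ (Nat.cast_ne_zero.2 (F.P K).L_pos.ne')) (w := fun _ => (1 : ℝ)) (fun _ => one_pos))
        (WithLp.toLp 2 (Pi.single t 1))) b : ℝ) : ℂ) • B t)
    (_ : ∀ (A : PBond (F.P K) 0 → Matrix (Fin N) (Fin N) ℂ) (b : PBond (F.P K) 0),
      MV A b = ∑ j, ((WithLp.ofLp ((QsE D
          ∘ₗ EE D (c := ((F.P K).L : ℝ) ^ (K - n)) (pow_ne_zero _ (Nat.cast_ne_zero.2 (F.P K).L_pos.ne')) (w := fun _ => (1 : ℝ)) (fun _ => one_pos)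
          ∘ₗ QE D ∘ₗ GE D (c := ((F.P K).L : ℝ) ^ (K - n)) (pow_ne_zero _ (Nat.cast_ne_zero.2 (F.P K).L_pos.ne')) (w := fun _ => (1 : ℝ)) (fun _ => one_pos))
        (WithLp.toLp 2 (Pi.single j 1))) b : ℝ) : ℂ) • A j)
        (X : PBond (F.P K) 0 → lieSU (Fin N)) (ρ' : ℝ) (_ : ρ' < ((((F.P K).L : ℝ)⁻¹) ^ (K - n)) * ε)
        (_ : ∀ b, w 1 b * ‖((X b : lieSU (Fin N)) : Matrix (Fin N) (Fin N) ℂ)‖ ≤ ρ')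
        (_ : ∀ (b : PBond (F.P K) 0) (ν : Fin 4),
          w 2 b * (F.L : ℝ) ^ (K - n) * ‖((X ⟨b.src.shift ν, b.dir⟩ : lieSU (Fin N)) : Matrix (Fin N) (Fin N) ℂ) - ((X b : lieSU (Fin N)) : Matrix (Fin N) (Fin N) ℂ)‖ ≤ ρ')
        (_ : ∀ φ : Matrix (Fin N) (Fin N) ℂ →L[ℂ] ℂ,
          RE D (((F.P K).L : ℝ) ^ (K - n)) (dsE (((F.P K).L : ℝ) ^ (K - n)) (WithLp.toLp 2 (fun b => (φ ((X b : lieSU (Fin N)) : Matrix (Fin N) (Fin N) ℂ)).re))) = 0)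
        (U₁ : GaugeField (F.P K) 0 (SU N))
        (_ : ∀ b, ((U₁ b : SU N) : Matrix (Fin N) (Fin N) ℂ) =
          ((expCfg ((((F.P K).L : ℝ)⁻¹) ^ (K - n))
            ((fun b => (Complex.I * (((((F.P K).L : ℝ)⁻¹) ^ (K - n) : ℝ) : ℂ))⁻¹ • ((X b : lieSU (Fin N)) : Matrix (Fin N) (Fin N) ℂ)) -
              H (Dsel (fun b => (Complex.I * (((((F.P K).L : ℝ)⁻¹) ^ (K - n) : ℝ) : ℂ))⁻¹ • ((X b : lieSU (Fin N)) : Matrix (Fin N) (Fin N) ℂ)))) b :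
            (Matrix (Fin N) (Fin N) ℂ)ˣ) : _))
        -- the criticality of the charted configuration, CELL FORM (print's (ii)-reading of [15] (156)–(157); no determining set)
        (_ : ∀ γ : ℝ → GaugeField (F.P K) 0 (SU N), γ 0 = U₁ →
          DifferentiableAt ℝ (fun (t : ℝ) (b : PBond (F.P K) 0) => ((γ t b : SU N) : Matrix (Fin N) (Fin N) ℂ)) 0 →
          (∀ (t : ℝ) (j : ℕ) (c : PBond (F.P K) j), j ≤ K - n → D.LamBond j c →
            avgFamily (avOfRecord F N K) (γ t) j c = avgFamily (avOfRecord F N K) U₁ j c) →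
          HasDerivAt (fun t => wilsonAction4 (γ t)) 0 0)
        {Y : Set (Site (F.P K) 0)} (_ : ∀ x ∈ Y, D.InOm (K - n) x) {t : ℝ}
        (_ : max B₀ (1 + (B₀ * B₃ + 1) * (F.L : ℝ) * CG) *
          ((2 * (((F.P K).L ^ (K - n) : ℝ) ^ 2 * ((((F.P K).L : ℝ)⁻¹) ^ (K - n)) ^ (F.P K).d * ((((F.P K).L : ℝ)⁻¹) ^ (K - n))⁻¹) *
            ((((F.P K).L : ℝ)⁻¹) ^ (K - n))⁻¹ ^ 2 * C₄) * ρ' ^ 2) < t),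
        Letters10On Y ((F.P K).eta (K - n)) t
          ((fun b => ((X b : lieSU (Fin N)) : Matrix (Fin N) (Fin N) ℂ)) - HV (QV fun b => ((X b : lieSU (Fin N)) : Matrix (Fin N) (Fin N) ℂ))) := by
  obtain ⟨Mh₀, R₀, B₀, δ₀, B₃, CG, hδ₀, hB₃, hCG, hA1⟩ := exists_letters10On_A1_closed_of_adm22_T4 (N := N) F
  obtain ⟨Mh₀', R₀', ε, C₄, hε, hC₄, hS⟩ := exists_sectF_W_flatScaled_atRecord_socket_A1rows_lam N F
  refine ⟨max Mh₀ Mh₀', max R₀ R₀', B₀, δ₀, B₃, CG, ε, C₄, hδ₀, hB₃, hCG, hε, hC₄, ?_⟩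
  intro n K h1K hKm Mh R a' hMha hMh₀ hR₀ ha' D hDk hAdm w hw
  obtain ⟨τ, ρ, BE, B, hc, hwa, MVf, H, Dsel, Qt, Ht, Dt, e, WS, hntr, hρ, hBE, hB, hMVf, hH, h55, hcd, hfix, hherm, hQt, hHt, hDt, he, h157, hdiff, h158,
    hsock, hWq, hWAtr⟩ := hS n K h1K hKm hMha (le_trans (le_max_right _ _) hMh₀) (le_trans (le_max_right _ _) hR₀) ha' D hDk hAdm hw
  refine ⟨H, Dsel, hH, h55, hcd, hfix, hherm, ?_⟩
  intro instDE instDB DV GV MV QV HV hDV hGV hQV hHV hMV X ρ' hρ' hX1 hX2 hslice U₁ hU₁ hcrit Y hY t ht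
  -- abbreviations
  set η : ℝ := (((F.P K).L : ℝ)⁻¹) ^ (K - n) with hηdef
  set c : ℝ := ((F.P K).L ^ (K - n) : ℝ) with hcdef
  have hL0 : (0 : ℝ) < (F.P K).L := Nat.cast_pos.2 (F.P K).L_pos
  have hη0 : 0 < η := by rw [hηdef]; positivity
  have hηne : η ≠ 0 := hη0.ne'
  have hcne : c ≠ 0 := by rw [hcdef]; positivity
  -- the Hermitian letter `A′₁ := (iη)⁻¹•⇑X`: herm0, in the two-size window
  set A₁ : PBond (F.P K) 0 → Matrix (Fin N) (Fin N) ℂ := fun b => (Complex.I * (η : ℂ))⁻¹ • ((X b : lieSU (Fin N)) : Matrix (Fin N) (Fin N) ℂ) with hA₁def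
  have hA₁h : ∀ b, A₁ b ∈ herm0 (Fin N) := fun b => inv_I_eta_smul_mem_herm0 (X b).2
  obtain ⟨hA₁1, hA₁2⟩ := hermLetter_rows_lt (P := F.P K) (Λ := (F.L : ℝ) ^ (K - n)) hη0 w X hρ' hX1 hX2
  -- the tangent letter `X₁ := X` in S1's carrier
  let X₁ : TangentBondSU (F.P K) 0 N := WithLp.toLp 2 X
  have hX₁ : ∀ b, ((X₁ b : lieSU (Fin N)) : Matrix (Fin N) (Fin N) ℂ) = (Complex.I * (η : ℂ)) • A₁ b := by
    intro b
    show ((X b : lieSU (Fin N)) : Matrix (Fin N) (Fin N) ℂ) = (Complex.I * (η : ℂ)) • ((Complex.I * (η : ℂ))⁻¹ • ((X b : lieSU (Fin N)) : Matrix (Fin N) (Fin N) ℂ))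
    rw [smul_smul, mul_inv_cancel₀ (mul_ne_zero Complex.I_ne_zero (Complex.ofReal_ne_zero.2 hηne)), one_smul]
  -- the fourth row `h128` from the socket (p643165), for the current `W_A₁ ⇑X = κ•(W_S A′₁)♮`
  have h128 := h128_of_socket127_flat (N := N) D hηne hcne (fun _ => (1 : ℝ)) hDV hQV X₁ hslice (BE (WS A₁))
    (fun j => (Complex.I * (c : ℂ) ^ 2 * (η : ℂ) ^ (F.P K).d * ((η : ℂ))⁻¹) • (WS A₁ j - (((N : ℂ))⁻¹ * (WS A₁ j).trace) • (1 : Matrix (Fin N) (Fin N) ℂ)))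
    (re_trace_pairing_rescaled_current_traceless η c hηne τ hntr BE hBE (WS A₁))
    (fun δ δX hδh hδQ hδX => hsock A₁ δ hA₁1 hA₁2 hA₁h hδh hδQ U₁ hU₁ hcrit X₁ δX hX₁ hδX)
  -- the A₁ line (p612312) with its four `W`-rows discharged
  exact hA1 n K h1K hKm hMha (le_trans (le_max_left _ _) hMh₀) (le_trans (le_max_left _ _) hR₀) ha' D hDk hAdm w hw hDV hGV hQV hHV hMV
    (fun Y b => (Complex.I * (c : ℂ) ^ 2 * (η : ℂ) ^ (F.P K).d * ((η : ℂ))⁻¹) •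
      (WS (fun b' => (Complex.I * (η : ℂ))⁻¹ • Y b') b - (((N : ℂ))⁻¹ * (WS (fun b' => (Complex.I * (η : ℂ))⁻¹ • Y b') b).trace) • (1 : Matrix (Fin N) (Fin N) ℂ)))
    hWq X (hWAtr X ρ' hρ' hX1 hX2).1 (hWAtr X ρ' hρ' hX1 hX2).2 h128 hρ' hX1 hX2 hslice hY ht

end Summit.QuantumFields.YangMills.BalabanUVNodes.N07Letters10OnA1OfFlatSocketLam

end
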